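import Summits.QuantumFields.BalabanUV.Beta.GAN24.VHClassCurrentSym

/-!
# `BalabanUV.Beta.GAN24.FaceDataVHChart` — binder row G-an2-4, crossed-ledger telescopy (γ) hand, letter K7-a (VH half): **AGAINST TWO
# FACE-SUPPORTED SINGLE-COORDINATE DATA THE PRODUCT-CHART BORDER LETTER `vhSAt` EQUALS THE ADDITIVE-CHART LETTER `vhSaddAt`** — the symmetric part
# `½([f = f′]·q¹(f) − q¹(f)·q¹(f′))` of an1's `m^ρ = vhKerAt ρ` drops (one window point: `χ′ − χ′² = 0`), leaving the pure rooted Hessian kernel `h^ρ = hessKerAt ρ`.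

NOT IN PRINT; OUR BOOKKEEPING ([folklore] finite algebra over an1's DEFINITIONS BY NAME: `AveragingHessianKernelsRooted.vhSAt ∕ vhSaddAt ∕ vhKerAt ∕ hessKerAt ∕
linKerAt ∕ vhCountAt ∕ hessCountAt ∕ vhKerAt_eq_zero_left ∕ _right ∕ hessKerAt_eq_zero_left ∕ _right`, `AveragingHessianKernels.packVH_inl_inr`, and leaf-04's
`GAN24.VHClassCurrentSym.vhKerAt_add_swap ∕ sum_nearBox_vhKerAt_symm_eq_zero`; G-an2-4 formalisation swarm, leaf prover `b2b-balaban-gan24-formalise-leaf-06`, gen 56).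
HONEST FRAMING (cell contract): «discharging `BetaPertH` makes Bałaban's UV stability UNCONDITIONAL — a real constructive-QFT result; it is NOT the continuum
limit and NOT the Clay problem» (verbatim): «continuum YM on T⁴ ⇐ BetaPertH ∧ nine spine estimates (0/9 proved); BetaPertH ⇐ (D1) ∧ (D4) ∧ CAP+tail; G-an2-4
gates asym, D1 and NE2».

WHY.  The (γ) hand's face∕cell reads of the E-frame forcing (`CrossedLedgerTelescope`'s `hface`, `hcell`) have an E⊗E half (typed: `FaceWordEECellOne`,
`FaceWordCurrentsDeep`, …) and a VH half: the E⊗VH ∕ VH⊗E face words carry the factor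
`Θ^{νβ}_m := Σ'_q h(q_β)·Σ'_u s(u_ν)·vhSAt ρ d L ν u q p (inl β) (inr m)` with BOTH data `h` (field leg) and `s` (slot leg) supported on the exit faces
`n ≡ −1 (mod L)` (the coarse-period face indicators are such data whenever `L ∣ N`).  The ENGINE (this lineage's gen-56 kits j222823, D = 2, and j224036, D = 3 —
weight 0, decide nothing here) finds `|Θ| ≤ 3·10⁻¹⁵` in every case while the E-currents are O(10⁻³).  leaf-04's `VHClassCurrentSym` types the slot↔leg
SYMMETRISED null (the antisymmetric `hessCountAt` drops under symmetrisation).  THIS FILE types the first half of the UNSYMMETRISED null: the symmetric part of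
`vhKerAt` ALONE already vanishes against two face-supported data, so `Θ` is the face contraction of the ADDITIVE-CHART letter `vhSaddAt` (an1's packing of
`hessKerAt`) and nothing else.  The second half — the additive-chart null `Σ'_q h(q_β)·Σ'_u s(u_ν)·vhSaddAt ρ d L ν u q p (inl β) (inr m) = 0`, a letter-level fact
about an1's rooted contours (`gammaCAt` = in-block axial path ++ straight `L`-segment ++ in-block return path: only the m-bonds of the two straight segments cross a
face, so every wedge has a vanishing component unless β = ν = m, where `pairForm` has equal components) — is NOT in this file.

WHAT ([folklore]; generic `d`, `1 ≤ L`, in-block root `r ∈ box L`; 0 `def`, 0 cited facts, 0 `def … : Prop`, 0 sorry): §1 `vhKerAt_eq_hessKerAt_add_symm`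
(`m^ρ(f,f′) = h^ρ(f,f′) + ½([f = f′]·q¹(f) − q¹(f)·q¹(f′))`); §2 `sum_nearBox_faceData_vhKerAt_eq_hessKerAt` (finite form on the support box); §3
**`vhSAt_faceData_eq_vhSaddAt`** (every free leg `(p, a)`: `Σ'_q h(q_β)·Σ'_u s(u_ν)·vhSAt ρ d L ν u q p (inl β) a = Σ'_q h(q_β)·Σ'_u s(u_ν)·vhSaddAt ρ d L ν u q p (inl β) a`)
and the mirrored `vhSAt_faceData_eq_vhSaddAt'` (free leg first).  Asserts NO value of Bałaban's tables beyond an1's DEFINED kernels; NOT (VAL-l), NOT «hXu», NOT D1,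
NOT `BetaPertH`, NOT continuum, NOT Clay.
-/

noncomputable section

open Finset
open scoped BigOperators
open Literature.MathematicalPhysics.QuantumFieldTheory.Balaban1983to89
open Literature.MathematicalPhysics.QuantumFieldTheory.Balaban1983to89.Beta
open AffineAveraging AveragingContours AveragingContoursRooted AveragingHessianKernels AveragingHessianKernelsRooted
open OneStepResolventKernel (Fib)
open Summit.QuantumFields.BalabanUV.Beta.LinearGaugeVH (nearBox mem_nearBox)
open Summit.QuantumFields.BalabanUV.Beta.GAN24.VHClassCurrentSym (vhKerAt_add_swap sum_nearBox_vhKerAt_symm_eq_zero)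

namespace Summit.QuantumFields.BalabanUV.Beta.GAN24.FaceDataVHChart

variable {d : ℕ}

/-! ## §1 The two charts differ by the symmetric part -/

section Kernel

/-- [folklore] **`m^ρ_b(f,f′) = h^ρ_b(f,f′) + ½([f = f′]·q¹_b(f) − q¹_b(f)·q¹_b(f′))`** (`vhCountAt = L^D·hessCountAt + L^D·[f=f′]·linCountAt − linCountAt⊗linCountAt`
over the normalisations `2L^{2D}`, `2L^D`, `L^D`). -/
theorem vhKerAt_eq_hessKerAt_add_symm {D : ℕ} {L : ℕ} (hL : 1 ≤ L) (ρ : Fin D → ℤ) (μ : Fin D) (y : Fin D → ℤ) (f f' : Bond D) :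
    vhKerAt ρ L μ y f f' = hessKerAt ρ L μ y f f'
      + (1 / 2) * ((if f = f' then linKerAt ρ L μ y f else 0) - linKerAt ρ L μ y f * linKerAt ρ L μ y f') := by
  have hL0 : (L : ℝ) ≠ 0 := by exact_mod_cast (Nat.one_le_iff_ne_zero.mp hL)
  rw [vhKerAt, vhCountAt, hessKerAt, linKerAt, linKerAt]
  by_cases hf : f = f'
  · subst hf
    simp only [if_true]
    push_cast
    field_simp
    ring
  · rw [if_neg hf, if_neg hf]
    push_cast
    field_simp
    ring

/-- [folklore] The symmetric part is HALF the symmetrised kernel: `½([f = f′]·q¹(f) − q¹(f)·q¹(f′)) = ½(m^ρ(f,f′) + m^ρ(f′,f))`. -/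
theorem vhKerAt_sub_hessKerAt_eq_half_add_swap {D : ℕ} {L : ℕ} (hL : 1 ≤ L) (ρ : Fin D → ℤ) (μ : Fin D) (y : Fin D → ℤ) (f f' : Bond D) :
    vhKerAt ρ L μ y f f' - hessKerAt ρ L μ y f f' = (1 / 2) * (vhKerAt ρ L μ y f f' + vhKerAt ρ L μ y f' f) := by
  rw [vhKerAt_add_swap hL, vhKerAt_eq_hessKerAt_add_symm hL]
  ring

end Kernel

/-! ## §2 Face-supported data on both legs: the symmetric part drops (finite form on the support box) -/

section Face

/-- [folklore] **PRODUCT CHART = ADDITIVE CHART AGAINST TWO FACE-SUPPORTED SINGLE-COORDINATE DATA** (finite form):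
`Σ_{q,u ∈ nearBox L y} h(q_β)s(u_ν)·m^ρ_{(m,y)}((β,q),(ν,u)) = Σ_{q,u ∈ nearBox L y} h(q_β)s(u_ν)·h^ρ_{(m,y)}((β,q),(ν,u))`. -/
theorem sum_nearBox_faceData_vhKerAt_eq_hessKerAt {L : ℕ} (hL : 1 ≤ L) {r : Fin (d + 1) → ℕ} (hr : r ∈ box (d + 1) L) (β ν m : Fin (d + 1))
    (y : Site (d + 1)) {h s : ℤ → ℝ} (hh : ∀ n : ℤ, n % (L : ℤ) ≠ (L : ℤ) - 1 → h n = 0) (hs : ∀ n : ℤ, n % (L : ℤ) ≠ (L : ℤ) - 1 → s n = 0) :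
    ∑ q ∈ nearBox L y, ∑ u ∈ nearBox L y, h (q β) * s (u ν) * vhKerAt (toSite r) L m y (β, q) (ν, u) =
      ∑ q ∈ nearBox L y, ∑ u ∈ nearBox L y, h (q β) * s (u ν) * hessKerAt (toSite r) L m y (β, q) (ν, u) := by
  rw [← sub_eq_zero, ← Finset.sum_sub_distrib]
  simp_rw [← Finset.sum_sub_distrib, ← mul_sub, vhKerAt_sub_hessKerAt_eq_half_add_swap hL]
  have e : ∑ q ∈ nearBox L y, ∑ u ∈ nearBox L y, h (q β) * s (u ν) * (1 / 2 * (vhKerAt (toSite r) L m y (β, q) (ν, u) + vhKerAt (toSite r) L m y (ν, u) (β, q))) =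
      (1 / 2) * ∑ q ∈ nearBox L y, ∑ u ∈ nearBox L y, h (q β) * s (u ν) * (vhKerAt (toSite r) L m y (β, q) (ν, u) + vhKerAt (toSite r) L m y (ν, u) (β, q)) := by
    rw [Finset.mul_sum]
    refine Finset.sum_congr rfl fun q _ => ?_
    rw [Finset.mul_sum]
    exact Finset.sum_congr rfl fun u _ => by ring
  rw [e, sum_nearBox_vhKerAt_symm_eq_zero hL hr β ν m y hh hs, mul_zero]

end Face

/-! ## §3 The letter: every free leg -/

section Letter

/-- [folklore] **THE VH LETTER AGAINST FACE DATA ON BOTH LEGS IS ITS ADDITIVE-CHART PART (weighted leg first, free leg second)**: for exit-face-supported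
single-coordinate data `h` (direction `β`, field leg) and `s` (direction `ν`, slot leg), `1 ≤ L`, `r ∈ box L`, every free leg `(p, a)`:
`Σ'_q h(q_β)·Σ'_u s(u_ν)·vhSAt ρ d L ν u q p (inl β) a = Σ'_q h(q_β)·Σ'_u s(u_ν)·vhSaddAt ρ d L ν u q p (inl β) a`
(field free legs: both sides are `0` — no ff block; multiplier free leg `(p, inr m)`, `p` coarse: §2 for the coarse bond `(m, p∕L)`). -/
theorem vhSAt_faceData_eq_vhSaddAt {L : ℕ} (hL : 1 ≤ L) {r : Fin (d + 1) → ℕ} (hr : r ∈ box (d + 1) L) (ν β : Fin (d + 1))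
    {h s : ℤ → ℝ} (hh : ∀ n : ℤ, n % (L : ℤ) ≠ (L : ℤ) - 1 → h n = 0) (hs : ∀ n : ℤ, n % (L : ℤ) ≠ (L : ℤ) - 1 → s n = 0)
    (p : Site (d + 1)) (a : Fib d) :
    ∑' q : Site (d + 1), h (q β) * ∑' u : Site (d + 1), s (u ν) * vhSAt (toSite r) d L rfl ν u q p (Sum.inl β) a =
      ∑' q : Site (d + 1), h (q β) * ∑' u : Site (d + 1), s (u ν) * vhSaddAt (toSite r) d L rfl ν u q p (Sum.inl β) a := by
  classical
  rcases a with α | m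
  · simp [vhSAt, vhSaddAt]
  · by_cases hp : off L p = 0
    · simp only [vhSAt, vhSaddAt, packVH_inl_inr, if_pos hp]
      set y := blk L p with hy
      -- both double `tsum`s are finite sums over the support box
      have hin : ∀ (g : ℤ → ℝ) (κ κ' : Fin (d + 1)) (q : Site (d + 1)),
          ∑' u : Site (d + 1), g (u κ) * vhKerAt (toSite r) L m y (κ', q) (κ, u) = ∑ u ∈ nearBox L y, g (u κ) * vhKerAt (toSite r) L m y (κ', q) (κ, u) := by
        intro g κ κ' q
        refine tsum_eq_sum fun u hu => ?_
        rw [vhKerAt_eq_zero_right hr _ (f' := (κ, u)) (fun hn => hu (mem_nearBox.2 hn)), mul_zero]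
      have hout : ∀ (g g' : ℤ → ℝ) (κ κ' : Fin (d + 1)),
          ∑' q : Site (d + 1), g' (q κ') * ∑ u ∈ nearBox L y, g (u κ) * vhKerAt (toSite r) L m y (κ', q) (κ, u) =
            ∑ q ∈ nearBox L y, g' (q κ') * ∑ u ∈ nearBox L y, g (u κ) * vhKerAt (toSite r) L m y (κ', q) (κ, u) := by
        intro g g' κ κ'
        refine tsum_eq_sum fun q hq => ?_
        rw [Finset.sum_eq_zero fun u _ => by rw [vhKerAt_eq_zero_left hr (f := (κ', q)) (fun hn => hq (mem_nearBox.2 hn)), mul_zero], mul_zero]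
      have hin' : ∀ (g : ℤ → ℝ) (κ κ' : Fin (d + 1)) (q : Site (d + 1)),
          ∑' u : Site (d + 1), g (u κ) * hessKerAt (toSite r) L m y (κ', q) (κ, u) = ∑ u ∈ nearBox L y, g (u κ) * hessKerAt (toSite r) L m y (κ', q) (κ, u) := by
        intro g κ κ' q
        refine tsum_eq_sum fun u hu => ?_
        rw [hessKerAt_eq_zero_right hr _ (f' := (κ, u)) (fun hn => hu (mem_nearBox.2 hn)), mul_zero]
      have hout' : ∀ (g g' : ℤ → ℝ) (κ κ' : Fin (d + 1)),
          ∑' q : Site (d + 1), g' (q κ') * ∑ u ∈ nearBox L y, g (u κ) * hessKerAt (toSite r) L m y (κ', q) (κ, u) =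
            ∑ q ∈ nearBox L y, g' (q κ') * ∑ u ∈ nearBox L y, g (u κ) * hessKerAt (toSite r) L m y (κ', q) (κ, u) := by
        intro g g' κ κ'
        refine tsum_eq_sum fun q hq => ?_
        rw [Finset.sum_eq_zero fun u _ => by rw [hessKerAt_eq_zero_left hr (f := (κ', q)) (fun hn => hq (mem_nearBox.2 hn)), mul_zero], mul_zero]
      simp_rw [hin, hin']
      rw [hout s h ν β, hout' s h ν β]
      simp_rw [Finset.mul_sum]
      have e1 : ∑ q ∈ nearBox L y, ∑ u ∈ nearBox L y, h (q β) * (s (u ν) * vhKerAt (toSite r) L m y (β, q) (ν, u)) =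
          ∑ q ∈ nearBox L y, ∑ u ∈ nearBox L y, h (q β) * s (u ν) * vhKerAt (toSite r) L m y (β, q) (ν, u) :=
        Finset.sum_congr rfl fun q _ => Finset.sum_congr rfl fun u _ => by ring
      have e2 : ∑ q ∈ nearBox L y, ∑ u ∈ nearBox L y, h (q β) * (s (u ν) * hessKerAt (toSite r) L m y (β, q) (ν, u)) =
          ∑ q ∈ nearBox L y, ∑ u ∈ nearBox L y, h (q β) * s (u ν) * hessKerAt (toSite r) L m y (β, q) (ν, u) :=
        Finset.sum_congr rfl fun q _ => Finset.sum_congr rfl fun u _ => by ring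
      rw [e1, e2, sum_nearBox_faceData_vhKerAt_eq_hessKerAt hL hr β ν m y hh hs]
    · simp only [vhSAt, vhSaddAt, packVH_inl_inr, if_neg hp, mul_zero, tsum_zero]

/-- [folklore] **THE VH LETTER AGAINST FACE DATA ON BOTH LEGS IS ITS ADDITIVE-CHART PART (free leg first, weighted leg second)** — `vhSAt` and `vhSaddAt` are
symmetric (`vhSAt_symm`, `vhSaddAt_symm`). -/
theorem vhSAt_faceData_eq_vhSaddAt' {L : ℕ} (hL : 1 ≤ L) {r : Fin (d + 1) → ℕ} (hr : r ∈ box (d + 1) L) (ν β : Fin (d + 1))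
    {h s : ℤ → ℝ} (hh : ∀ n : ℤ, n % (L : ℤ) ≠ (L : ℤ) - 1 → h n = 0) (hs : ∀ n : ℤ, n % (L : ℤ) ≠ (L : ℤ) - 1 → s n = 0)
    (p : Site (d + 1)) (a : Fib d) :
    ∑' q : Site (d + 1), h (q β) * ∑' u : Site (d + 1), s (u ν) * vhSAt (toSite r) d L rfl ν u p q a (Sum.inl β) =
      ∑' q : Site (d + 1), h (q β) * ∑' u : Site (d + 1), s (u ν) * vhSaddAt (toSite r) d L rfl ν u p q a (Sum.inl β) := by
  have e : ∀ (u q : Site (d + 1)), vhSAt (toSite r) d L rfl ν u p q a (Sum.inl β) = vhSAt (toSite r) d L rfl ν u q p (Sum.inl β) a :=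
    fun u q => vhSAt_symm (toSite r) L ν u p q a (Sum.inl β)
  have e' : ∀ (u q : Site (d + 1)), vhSaddAt (toSite r) d L rfl ν u p q a (Sum.inl β) = vhSaddAt (toSite r) d L rfl ν u q p (Sum.inl β) a :=
    fun u q => vhSaddAt_symm (toSite r) L ν u p q a (Sum.inl β)
  simp_rw [e, e']
  exact vhSAt_faceData_eq_vhSaddAt hL hr ν β hh hs p a

end Letter

end Summit.QuantumFields.BalabanUV.Beta.GAN24.FaceDataVHChart

end
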